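import Mathlib
import Summits.Ventures.PercRepro2.SwOutCoreDefs
import Summits.Ventures.PercRepro2.SwOutJunctionH1GTypedSides

/-!
# The multi-root core cube: the concrete vocabulary (blind cell PercRepro2, night-4 g34,
2026-08-29; proofs/NIGHT4-G34.md §6)

For a set `R` of roots and a configuration `ζ`: the extended hull `extHullR` (the union of the
hulls of the roots), its red and blue parts `redPartR` / `bluePartR` (the clusters of the roots
without the roots), the arms `armR` (the components of `G[extHullR ∖ R]`), the finite family
`armsR` of the arms reached by a root edge, the base `baseR` (the blue part flipped) and the cube
point `omegaR` of `ζ` (an arm is `true` iff it is not blue); the basic facts (an arm of a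
non-root vertex of the extended hull lies in `extHullR ∖ R`, two vertices joined by an edge inside
it have the same arm, the family of arms depends on the extended hull only, the arm of the non-root
end of a root edge is one of the arms).  The structure at a non-escaping side point is in
SwOutMultiRootSides / SwOutMultiRootBase.
-/

namespace Summit.Ventures.PercRepro2

namespace LocRows

open Hull

variable {V : Type*} {E : Type*}

open scoped Classical

variable {ends : E → Sym2 V}

section Defs

variable (ends) (R : Set V) (ζ : Config E)

/-- The extended hull of the roots: the union of their hulls. -/
def extHullR : Set V := {x | ∃ r ∈ R, x ∈ hull ends ζ r}

/-- The red part of the extended hull: the red clusters of the roots, without the roots. -/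
def redPartR : Set V := {x | (∃ r ∈ R, x ∈ cluster ends ζ r) ∧ x ∉ R}

/-- The blue part of the extended hull. -/
def bluePartR : Set V := {x | (∃ r ∈ R, x ∈ cluster ends (blue ζ) r) ∧ x ∉ R}

/-- The all-open colouring of the edges inside the extended hull without the roots. -/
noncomputable def armConfigR : Config E :=
  fun e => decide (e ∈ within ends (extHullR ends R ζ \ R))

/-- The arm of `x`: its component in `G[extHullR ∖ R]`. -/
noncomputable def armR (x : V) : Set V := cluster ends (armConfigR ends R ζ) x

/-- The edges from a root to a non-root. -/
noncomputable def rootEdgesR [Fintype E] [DecidableEq E] : Finset E :=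
  Finset.univ.filter fun e => ∃ r ∈ R, ∃ y, ends e = s(r, y) ∧ y ∉ R

/-- The arm reached by a root edge: the arm of its non-root end. -/
noncomputable def armOfEdgeR (e : E) : Set V := {x | ∃ y ∈ ends e, y ∉ R ∧ x ∈ armR ends R ζ y}

/-- The finite family of arms (the arms reached by a root edge). -/
noncomputable def armsR [Fintype E] [DecidableEq E] : Finset (Set V) :=
  (rootEdgesR ends R).image (armOfEdgeR ends R ζ)

/-- The base of `ζ`: the blue part flipped. -/
noncomputable def baseR : Config E := flip ends (bluePartR ends R ζ) ζ

end Defs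

section Basic

variable {R : Set V} {ζ : Config E}

/-- A root lies in the extended hull. -/
lemma mem_extHullR_of_mem {r : V} (hr : r ∈ R) : r ∈ extHullR ends R ζ :=
  ⟨r, hr, Or.inl (mem_cluster_self _ _ _)⟩

/-- The red part lies in the extended hull. -/
lemma redPartR_subset : redPartR ends R ζ ⊆ extHullR ends R ζ := by
  rintro x ⟨⟨r, hr, hx⟩, -⟩
  exact ⟨r, hr, Or.inl hx⟩

/-- The blue part lies in the extended hull. -/
lemma bluePartR_subset : bluePartR ends R ζ ⊆ extHullR ends R ζ := by
  rintro x ⟨⟨r, hr, hx⟩, -⟩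
  exact ⟨r, hr, Or.inr hx⟩

/-- A non-root vertex of the extended hull lies in the red or in the blue part. -/
lemma mem_redPartR_or_bluePartR {x : V} (hx : x ∈ extHullR ends R ζ) (hxR : x ∉ R) :
    x ∈ redPartR ends R ζ ∨ x ∈ bluePartR ends R ζ := by
  obtain ⟨r, hr, hx | hx⟩ := hx
  · exact Or.inl ⟨⟨r, hr, hx⟩, hxR⟩
  · exact Or.inr ⟨⟨r, hr, hx⟩, hxR⟩

/-- `x` lies in its arm. -/
lemma mem_armR_self (x : V) : x ∈ armR ends R ζ x := mem_cluster_self _ _ _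

/-- The arm of a vertex of the arm of `x` is the arm of `x`. -/
lemma armR_eq_of_mem {x y : V} (hy : y ∈ armR ends R ζ x) : armR ends R ζ y = armR ends R ζ x := by
  ext v
  constructor
  · exact fun hv => conn_trans hy hv
  · exact fun hv => conn_trans (conn_symm hy) hv

/-- An arm of a vertex of the extended hull outside the roots lies in the extended hull outside
the roots. -/
lemma armR_subset {x : V} (hx : x ∈ extHullR ends R ζ) (hxR : x ∉ R) :
    armR ends R ζ x ⊆ extHullR ends R ζ \ R := by
  intro y hy
  refine mem_of_conn_of_closed (ends := ends) (ω := armConfigR ends R ζ) ?_ ⟨hx, hxR⟩ hy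
  intro a ha b hab
  obtain ⟨-, e, he, hab'⟩ := exists_edge_of_adj hab
  simp only [armConfigR, decide_eq_true_eq] at he
  obtain ⟨p, hp, q, hq, hpq⟩ := he
  rw [hab', Sym2.eq_iff] at hpq
  rcases hpq with ⟨rfl, rfl⟩ | ⟨rfl, rfl⟩
  · exact hq
  · exact hp

/-- Two vertices of `extHullR ∖ R` joined by an edge have the same arm. -/
lemma armR_eq_of_edge {e : E} {x y : V} (hxy : ends e = s(x, y)) (hx : x ∈ extHullR ends R ζ \ R)
    (hy : y ∈ extHullR ends R ζ \ R) : armR ends R ζ y = armR ends R ζ x := by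
  apply armR_eq_of_mem
  have he : armConfigR ends R ζ e = true := by
    simp only [armConfigR, decide_eq_true_eq]
    exact ⟨x, hx, y, hy, hxy⟩
  exact mem_cluster_of_edge (mem_cluster_self _ _ _) he hxy

/-- The family of arms depends on the extended hull only. -/
lemma armsR_congr [Fintype E] [DecidableEq E] {ζ' : Config E}
    (hH : extHullR ends R ζ = extHullR ends R ζ') : armsR ends R ζ = armsR ends R ζ' := by
  have hc : armConfigR ends R ζ = armConfigR ends R ζ' := by
    funext e; simp only [armConfigR, hH]
  have ha : armOfEdgeR ends R ζ = armOfEdgeR ends R ζ' := by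
    funext e; simp only [armOfEdgeR, armR, hc]
  simp only [armsR, ha]


/-- The arm reached by a root edge is the arm of its non-root end. -/
lemma armOfEdgeR_eq {e : E} {r y : V} (hr : r ∈ R) (hry : ends e = s(r, y)) (hy : y ∉ R) :
    armOfEdgeR ends R ζ e = armR ends R ζ y := by
  ext x
  simp only [armOfEdgeR, Set.mem_setOf_eq]
  constructor
  · rintro ⟨y', hy', hy'R, hx⟩
    rw [hry, Sym2.mem_iff] at hy'
    rcases hy' with rfl | rfl
    · exact absurd hr hy'R
    · exact hx
  · intro hx
    exact ⟨y, by rw [hry]; exact Sym2.mem_mk_right r y, hy, hx⟩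

/-- The arm of the non-root end of a root edge is one of the arms. -/
lemma armR_mem_armsR [Fintype E] [DecidableEq E] {e : E} {r y : V} (hr : r ∈ R)
    (hry : ends e = s(r, y)) (hy : y ∉ R) : armR ends R ζ y ∈ armsR ends R ζ := by
  rw [← armOfEdgeR_eq hr hry hy]
  exact Finset.mem_image_of_mem _ (by
    simp only [rootEdgesR, Finset.mem_filter, Finset.mem_univ, true_and]
    exact ⟨r, hr, y, hry, hy⟩)

end Basic

section Omega

variable (ends : E → Sym2 V) (R : Set V) (ζ : Config E)

/-- The cube point of the side point: an arm is `true` iff it is not a blue arm. -/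
noncomputable def omegaR [Fintype E] [DecidableEq E] : ↥(armsR ends R ζ) → Bool :=
  fun P => decide (¬ P.1 ⊆ bluePartR ends R ζ)

end Omega

end LocRows

end Summit.Ventures.PercRepro2
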